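import Literature.AlgebraicGeometry.Modules.RankOneCocycle
import Mathlib.LinearAlgebra.Matrix.Determinant.Basic
import HarnessLib

/-!
# [OURS · L1 W4.5(b) · EL♮(3) (L) brick C2, sub-brick Σ1] Cocycle algebra of the bridge: `[𝒩] · [F] = [L]²` from a local identity

Cell res-hironaka, LADDER-RESOLUTION rung L, slot W4.5(b), crux chain w45b: EL♮(3) = stmt-ResolutionOfSingularities-20148, brick C2 of
`Tower.hLift_of_bricks` (census `Cruxes/EquisingularLiftNatThree/Lines/C2-CENSUS-res-type-027.md`; the (★) theorem
`cechPic_pullback_detClass_conormal_section`, sig `L/res-type-027/Bstar-ConormalSectionClass.sig.lean`). Seat res-type-027 g15.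
`--supports stmt-ResolutionOfSingularities-20148 --as helper`. OURS; NOT a statement of any manuscript; AI-written, weaker than expert review.
Definition-free; standard axioms.

The class identity of (★) is reduced here to POINTWISE data: a rank-two module `F` framed on a point-indexed cover by frames `e_p` ADAPTED to a
cocycle `c_L` (the first basis vector spans a line with transition `c_L`: `T(e_p, e_q)₀₀ = g^L_{pq}`, `T(e_p, e_q)₁₀ = 0`), and a cocycle `c_N` which,
LOCALLY around every point of every overlap, satisfies `g^N_{pq} · T(e_p,e_q)₁₁ = T(e_p,e_q)₀₀`. Then `[c_N] · [det F] = [c_L]²` in `Ȟ¹(Y, 𝒪^×)`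
(`det T = T₀₀ T₁₁`, the local identity glues by the sheaf property, `UnitCocycle.equiv_of_eq`). In (★): `F = g^*ε^*𝒞_{V(I)}` framed by the
direction-adapted frames, `c_L` = the proportional cocycle of `L₀`, `c_N = Φ^*` of the cocycle of the conormal bundle of the section (sub-brick B1c
supplies the local identity). [cite: Hartshorne1977, II Ex. 5.16, III Ex. 4.5] [folklore]
-/

noncomputable section

open CategoryTheory AlgebraicGeometry TopologicalSpace Opposite
open Literature.AlgebraicGeometry.Modules Literature.AlgebraicGeometry.Motives

set_option linter.dupNamespace false

namespace Summit.ResolutionOfSingularities.ResolutionOfSingularities.Cruxes.EquisingularLiftNat.Sections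

variable {Y : Scheme.{0}} {F : Y.Modules}

/-- The determinant of the transition matrix of two `Fin 2`-frames with vanishing `(1,0)` entry is the product of the diagonal entries. [folklore] -/
theorem transitionDet_fin_two_of_lower {U V W : Y.Opens} (e : SheafOfModules.free (Fin 2) ≅ F.over U) (e' : SheafOfModules.free (Fin 2) ≅ F.over W)
    (k : V ⟶ U) (k' : V ⟶ W) (h10 : transition e e' k k' 1 0 = 0) :
    transitionDet e e' (Equiv.refl (Fin 2)) (Equiv.refl (Fin 2)) k k' = transition e e' k k' 0 0 * transition e e' k k' 1 1 := by
  rw [transitionDet_eq, Matrix.det_fin_two, stdTransition_apply, stdTransition_apply, stdTransition_apply, stdTransition_apply]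
  simp only [Equiv.refl_symm, Equiv.refl_apply]
  rw [h10, mul_zero, sub_zero]

/-- **`[c_N] · [det F] = [c_L]²` from adapted frames and a local identity** (see the module docstring). -/
theorem cechPic_mk_mul_detClass_eq_sq (hF : IsFiniteLocallyFree F)
    (U : Y → Y.Opens) (hmem : ∀ p, p ∈ U p) (e : ∀ p, SheafOfModules.free (Fin 2) ≅ F.over (U p))
    (cL cN : UnitCocycle Y) (hUL : ∀ p, U p ≤ cL.U p) (hUN : ∀ p, U p ≤ cN.U p)
    (h00 : ∀ (p q : Y) (V : Y.Opens) (hp : V ≤ U p) (hq : V ≤ U q),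
      transition (e p) (e q) (homOfLE hp) (homOfLE hq) 0 0 = cL.g p q V (hp.trans (hUL p)) (hq.trans (hUL q)))
    (h10 : ∀ (p q : Y) (V : Y.Opens) (hp : V ≤ U p) (hq : V ≤ U q), transition (e p) (e q) (homOfLE hp) (homOfLE hq) 1 0 = 0)
    (hloc : ∀ (p q : Y) (V : Y.Opens) (hp : V ≤ U p) (hq : V ≤ U q) (v : Y), v ∈ V →
      ∃ (V' : Y.Opens) (hV' : V' ≤ V), v ∈ V' ∧
        cN.g p q V' ((hV'.trans hp).trans (hUN p)) ((hV'.trans hq).trans (hUN q)) *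
            transition (e p) (e q) (homOfLE (hV'.trans hp)) (homOfLE (hV'.trans hq)) 1 1 =
          transition (e p) (e q) (homOfLE (hV'.trans hp)) (homOfLE (hV'.trans hq)) 0 0) :
    CechPic.mk cN * detClass hF = CechPic.mk cL ^ 2 := by
  classical
  -- the frame system of `F`
  let FS : FrameSystem F :=
    { U := U, mem := hmem, I := fun _ => Fin 2, rank := fun _ => 2, enum := fun _ => Equiv.refl (Fin 2), frame := e }
  -- the global identity `g^N · T₁₁ = T₀₀` on every `V ≤ U_p ∩ U_q`, glued from `hloc`
  have hglob : ∀ (p q : Y) (V : Y.Opens) (hp : V ≤ U p) (hq : V ≤ U q),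
      cN.g p q V (hp.trans (hUN p)) (hq.trans (hUN q)) * transition (e p) (e q) (homOfLE hp) (homOfLE hq) 1 1 =
        transition (e p) (e q) (homOfLE hp) (homOfLE hq) 0 0 := by
    intro p q V hp hq
    choose V' hV' hvV' hV'eq using fun v : V => hloc p q V hp hq v.1 v.2
    apply TopCat.Sheaf.eq_of_locally_eq' Y.sheaf V' V (fun v => homOfLE (hV' v))
      (fun v hv => Opens.mem_iSup.mpr ⟨⟨v, hv⟩, hvV' ⟨v, hv⟩⟩)
    intro v
    change Y.presheaf.map (homOfLE (hV' v)).op _ = Y.presheaf.map (homOfLE (hV' v)).op _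
    rw [map_mul]
    have hg := cN.map_g p q (hp.trans (hUN p)) (hq.trans (hUN q)) (hV' v)
    change Y.presheaf.map (homOfLE (hV' v)).op _ = _ at hg
    have htr : ∀ i j : Fin 2, Y.presheaf.map (homOfLE (hV' v)).op (transition (e p) (e q) (homOfLE hp) (homOfLE hq) i j) =
        transition (e p) (e q) (homOfLE ((hV' v).trans hp)) (homOfLE ((hV' v).trans hq)) i j := by
      intro i j
      have h := congrFun (congrFun (transition_map (e p) (e q) (homOfLE hp) (homOfLE hq) (homOfLE (hV' v))) i) j
      rw [Matrix.map_apply] at h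
      rw [Subsingleton.elim (homOfLE ((hV' v).trans hp)) (homOfLE (hV' v) ≫ homOfLE hp),
        Subsingleton.elim (homOfLE ((hV' v).trans hq)) (homOfLE (hV' v) ≫ homOfLE hq)]
      exact h
    rw [hg, htr, htr]
    exact hV'eq v
  -- cocycle algebra
  rw [detClass_eq_mk hF FS, ← CechPic.mk_mul, pow_two, ← CechPic.mk_mul]
  refine CechPic.sound (UnitCocycle.equiv_of_eq _ _ U hmem (fun p => le_inf (hUN p) le_rfl) (fun p => le_inf (hUL p) (hUL p))
    fun p q V hp hq => ?_)
  change cL.g p q V _ _ * cL.g p q V _ _ = cN.g p q V _ _ * FS.cocycle.g p q V _ _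
  rw [FrameSystem.cocycle_g]
  change _ = _ * transitionDet (e p) (e q) (Equiv.refl (Fin 2)) (Equiv.refl (Fin 2)) (homOfLE hp) (homOfLE hq)
  rw [transitionDet_fin_two_of_lower (e p) (e q) _ _ (h10 p q V hp hq), mul_left_comm, hglob p q V hp hq, h00 p q V hp hq]

end Summit.ResolutionOfSingularities.ResolutionOfSingularities.Cruxes.EquisingularLiftNat.Sections

end
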